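import Summits.BirchSwinnertonDyer.Rank1Residual.X11b.Three.CyclotomicNonsplitUpper
import Literature.NumberTheory.EllipticCurves.Wuthrich2014.ThreeAdicImageSupersingularProofs
import HarnessLib

/-!
# X11b at `p = 3`, NON-SPLIT multiplicative `3`, `ρ̄_{E,3}` onto: the Euler-system half and the closing
# theorem WITHOUT the binder `h20` (Wuthrich's Lemma 20 is a tree theorem)

HONEST FRAMING (cell `b2b-bsdres`, run/shared/lean/b2b/bsd-rank1-residual/, verbatim in every
file): the goal of the cell is to DELETE the COMBINATION-SHAPED residual classes of the
Birch–Swinnerton-Dyer formula for ALL analytic-rank `≤ 1` elliptic curves over `ℚ` — "full BSD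
formula for every rank `≤ 1` curve in class `C`" assembled STRICTLY from published theorems — so
that the rank-`≤ 1` remainder becomes exactly the CONSTRUCTION-SHAPED classes, which are TYPED
(missing-input `Prop`s), NOT attempted. This is not "finishing BSD". Team n1011 (N10 / N11), seat
p05, OWNERS row T-b1ss = the `hL20`-BINDER SWEEP: Wuthrich's Lemma 20 (registry A9, the named fact
`Wuthrich2014.lemma20_surjective_threeAdic_of_semistable`: at a prime-to-`9` conductor, `ρ̄_{E,3}`
onto ⟹ `ρ̄_{E,3ⁿ}` onto for all `n`) is a tree THEOREM since 2026-08-21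
(`Wuthrich2014.lemma20_surjective_threeAdic_of_semistable_holds`, file
`Literature/NumberTheory/EllipticCurves/Wuthrich2014/ThreeAdicImageSupersingularProofs.lean`, units
lit-kato / n1011-p02), so every theorem of the cell carrying it as a hypothesis has a twin WITHOUT that
binder.  This file states those twins for the theorems of its sibling (suffix `_noL20`; statement =
the sibling's statement with the binder deleted; proof = the sibling's theorem fed with `_holds`).
No claim beyond the stated classes; labels UNCHANGED; nothing is booked.  Theorems only (no
definition, no named fact minted).

## What this file proves

Binder-free twins of `missingUpperBoundAt_three_of_isX11Three_of_nonsplit_of_surj_of_schneider` and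
`bsdp_three_of_isX11Three_of_nonsplit_of_surj_of_schneider_of_pow_dvd`
(`X11b/Three/CyclotomicNonsplitUpper.lean`): statement = the original with
`(h20 : lemma20_surjective_threeAdic_of_semistable)` deleted.  CONDITIONAL on the sibling's remaining
named facts and the per-pair Schneider instance, exactly as there; nothing booked.

References: [Wuthrich2014] C. Wuthrich, Doc. Math. 19 (2014), Lemma 20 (p. 399), Thm. 3;
[SteinWuthrich2013] Thm. 6.1; [Disegni2020] Thm. 1, Thm. 4; [Miller2011LMS] Def. 1.1.
-/

noncomputable section

open scoped Classical MatrixGroups ModularForm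

open CongruenceSubgroup WeierstrassCurve Literature.NumberTheory.EllipticCurves
  Literature.NumberTheory.EllipticCurves.ModularForms
  Literature.NumberTheory.EllipticCurves.Rank1Residual
  Literature.NumberTheory.EllipticCurves.Rank1Residual.X11RankOneCertificates
  Literature.NumberTheory.EllipticCurves.Skinner2016
  Literature.NumberTheory.EllipticCurves.SteinWuthrich2013
  Literature.NumberTheory.EllipticCurves.Disegni2020
  Literature.NumberTheory.EllipticCurves.Wuthrich2014

namespace Summit.BirchSwinnertonDyer.Rank1Residual.X11b.Three

/-- **Binder-free twin of `missingUpperBoundAt_three_of_isX11Three_of_nonsplit_of_surj_of_schneider`**: the same statement WITHOUT the hypothesis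
`Wuthrich2014.lemma20_surjective_threeAdic_of_semistable` (now the tree theorem `…_holds`).
[cite: Wuthrich2014, Thm. 3 (p. 382)] [cite: SteinWuthrich2013, Thm. 6.1 (p. 20)] [cite: Disegni2020, Thm. 1 and Thm. 4] [cite: Miller2011LMS, Def. 1.1]
[cite: Wuthrich2014, Lemma 20 (p. 399)] -/
theorem missingUpperBoundAt_three_of_isX11Three_of_nonsplit_of_surj_of_schneider_noL20
    [Fact (Nat.Prime 3)] (hK : kato_charIdeal_dvd_multiplicative_of_surjective)
    (hJ : thm61_nonsplitMultiplicative)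
    (hD : thm1_padicBSD_nonsplitMultiplicative) (hH : exists_isMultCanonical)
    (hLns : exists_isMultPAdicLFunctionOf_neg_one)
    (hGZK : rank_eq_analyticRank_of_analyticRank_le_one)
    (hpar : nonempty_modularParametrizationData)
    (W : WeierstrassCurve ℚ) [W.IsElliptic] [W.IsGloballyMinimal] (hX : IsX11Three W)
    (hns : ¬ W.HasSplitMultiplicativeReductionAtPrime 3) (hρ : Surj W 3)
    (hSch : ∀ q : ℚ_[3], q ≠ 0 → ‖q‖ < 1 → tateJ q = (W.j : ℚ_[3]) →
      ∀ Dh : PAdicHeightData W 3, IsMultCanonical Dh q → SchneiderConjecture Dh) :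
    Typed.MissingUpperBoundAt W 3 :=
  missingUpperBoundAt_three_of_isX11Three_of_nonsplit_of_surj_of_schneider hK
    Wuthrich2014.lemma20_surjective_threeAdic_of_semistable_holds hJ hD hH hLns hGZK hpar W hX hns hρ hSch

/-- **Binder-free twin of `bsdp_three_of_isX11Three_of_nonsplit_of_surj_of_schneider_of_pow_dvd`**: the same statement WITHOUT the hypothesis
`Wuthrich2014.lemma20_surjective_threeAdic_of_semistable` (now the tree theorem `…_holds`).
[cite: Wuthrich2014, Thm. 3 (p. 382)] [cite: SteinWuthrich2013, Thm. 6.1 (p. 20)] [cite: Disegni2020, Thm. 1 and Thm. 4] [cite: Miller2011LMS, Def. 1.1]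
[cite: Wuthrich2014, Lemma 20 (p. 399)] -/
theorem bsdp_three_of_isX11Three_of_nonsplit_of_surj_of_schneider_of_pow_dvd_noL20
    [Fact (Nat.Prime 3)] (hK : kato_charIdeal_dvd_multiplicative_of_surjective)
    (hJ : thm61_nonsplitMultiplicative)
    (hD : thm1_padicBSD_nonsplitMultiplicative) (hH : exists_isMultCanonical)
    (hLns : exists_isMultPAdicLFunctionOf_neg_one)
    (hGZK : rank_eq_analyticRank_of_analyticRank_le_one)
    (hpar : nonempty_modularParametrizationData)
    (W : WeierstrassCurve ℚ) [W.IsElliptic] [W.IsGloballyMinimal] (hX : IsX11Three W)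
    (hns : ¬ W.HasSplitMultiplicativeReductionAtPrime 3) (hρ : Surj W 3)
    (hSch : ∀ q : ℚ_[3], q ≠ 0 → ‖q‖ < 1 → tateJ q = (W.j : ℚ_[3]) →
      ∀ Dh : PAdicHeightData W 3, IsMultCanonical Dh q → SchneiderConjecture Dh)
    {j : ℕ} (hdvd : 3 ^ j ∣ W.shaOrder) {s : ℚ} (hs : shaAn W = (s : ℂ))
    (hv : padicValRat 3 s ≤ j) : BSDp W 3 :=
  bsdp_three_of_isX11Three_of_nonsplit_of_surj_of_schneider_of_pow_dvd hK
    Wuthrich2014.lemma20_surjective_threeAdic_of_semistable_holds hJ hD hH hLns hGZK hpar W hX hns hρ hSch hdvd hs hv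

end Summit.BirchSwinnertonDyer.Rank1Residual.X11b.Three

end
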